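import Literature.Geometry.Riemannian.RoundSphere
import Literature.Geometry.Riemannian.RiemannianDistance
import Literature.Geometry.Lorentzian.VolumeChartIntegral
import Literature.Geometry.Lorentzian.VolumeProofs
import Mathlib.Analysis.InnerProductSpace.Calculus
import Mathlib.MeasureTheory.Constructions.HaarToSphere
import Mathlib.MeasureTheory.Measure.Lebesgue.VolumeOfBalls
import Mathlib.MeasureTheory.Integral.IntegralEqImproper
import Mathlib.Analysis.SpecialFunctions.Integrals.Basic
import HarnessLib

/-!
# The volume of the round unit `4`-sphere: `Vol(S⁴) = ω₄ = 8π²/3`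

For the round metric `g_S = roundMetric V` on the unit sphere `Sⁿ = sphere (0 : V) 1` of an
`(n+1)`-dimensional real inner product space (`RoundSphere.lean`; O'Neill 1983, Ch. 3, Def. 3.4)
and the tree's Riemannian measure `dV = riemannianMeasure` (`Lorentzian/Volume.lean`: the
Euclidean-normalised `n`-dimensional Hausdorff measure of the length metric; in charts
`dV = √(det h_{ij}) dy`, `riemannianMeasure_eq_integral_sqrt_det_holds`,
`map_extChartAt_restrict_riemannianMeasure`), this file computes, entirely inside the tree,

* `inner_fderiv_stereoInvFunAux` — **the inverse stereographic projection is conformal**: for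
  Mathlib's `stereoInvFunAux v : w ↦ (‖w‖² + 4)⁻¹ (4w + (‖w‖² − 4) v)` (pole `v`, `‖v‖ = 1`,
  plane `vᗮ`, scaled so that the equator corresponds to `‖w‖ = 2`) and `w, ξ, η ⊥ v`,
  `⟪D(w)ξ, D(w)η⟫ = (4/(‖w‖²+4))² ⟪ξ, η⟫` (`hasFDerivAt_stereoInvFunAux_apply` is the explicit
  differential; Lee 2018, proof of Prop. 3.5 / Exercise 3-6: stereographic projection is a
  conformal diffeomorphism, `(σ⁻¹)^* g_S = 4(1+|u|²)⁻² |du|²` in the unscaled normalisation);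
* `chartGramMatrix_roundMetric` — hence **the round metric is conformally flat in Mathlib's
  stereographic charts**: `h_{ij}(y) = (4/(‖y‖²+4))² δ_{ij}` for the chart `extChartAt (𝓡 n) v`
  (`= stereographic' n (−v)` followed by an isometry `(−v)ᗮ ≃ ℝⁿ`), and
  `sqrt_det_chartGramMatrix_roundMetric`: `√(det h_{ij}(y)) = (4/(‖y‖²+4))ⁿ`;
* `integral_conformalFactor_four` — `∫_{ℝ⁴} (4/(‖y‖²+4))⁴ dy = 8π²/3` (polar coordinates,
  Mathlib's `integral_fun_norm_addHaar`, `|B⁴| = π²/2`, and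
  `∫₀^∞ t³ (4/(t²+4))⁴ dt = 4/3` by the primitive `−64(t²+4)⁻² + (512/3)(t²+4)⁻³`);
* `riemannianMeasure_roundMetric_sphere_four_univ` — **`Vol(S⁴, g_S) = 8π²/3`**
  (`= ω₄`, the volume of the unit `4`-sphere; Aubin 1982, Thm. 6.7: "`ω_n` is the volume of
  the unit sphere of radius `1` and dimension `n`"; here `n = 4`: `ω₄ = 2π^{5/2}/Γ(5/2) = 8π²/3`):
  one stereographic chart covers `S⁴` up to a point, which is `dV`-null, and the chart formula
  reduces the volume to the integral above. Also in real form,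
  `toReal_riemannianMeasure_roundMetric_sphere_four_univ`.

This is the normalising constant of Aubin's Thm. 6.12 on `S⁴` (`μ = n(n−1)ω_n^{2/n}`,
`12 ω₄^{1/2} = 8√6 π`; see `AubinYamabeSphere.lean`, `AubinYamabeSphereProofs.lean`). Everything is
proved; no definitions, no named facts.

## References

* T. Aubin, *Nonlinear Analysis on Manifolds. Monge–Ampère Equations*, Grundlehren 252, Springer
  1982, Ch. 6, Thm. 6.7 (definition of `ω_n`) and Thm. 6.12. [Aubin1982]
* J. M. Lee, *Introduction to Riemannian Manifolds*, 2nd ed., Springer 2018, Prop. 2.41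
  (`dV_g = √(det g_{ij}) dy`), Ch. 3 (stereographic coordinates, `(σ⁻¹)^* g̊ = 4|du|²/(1+|u|²)²`).
  [Lee2018]
* B. O'Neill, *Semi-Riemannian geometry*, Academic Press 1983, Ch. 3, Def. 3.4 and p. 57
  (the standard sphere as a Riemannian submanifold). [ONeill1983]
* H. Federer, *Geometric Measure Theory*, Springer 1969, §3.2.46 (Hausdorff measure of a
  Riemannian manifold). [Federer1969]
-/

noncomputable section

open scoped RealInnerProductSpace Manifold ContDiff Topology ENNReal
open Metric Module Bundle Set MeasureTheory Filter

namespace Literature.Geometry.Riemannian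

open Literature.Geometry.Lorentzian
open Literature.Geometry.Lorentzian.PseudoRiemannianMetric

/-! ### The differential of the inverse stereographic projection and its conformality -/

section Stereographic

variable {E : Type*} [NormedAddCommGroup E] [InnerProductSpace ℝ E]

/-- **The differential of Mathlib's inverse stereographic projection** `stereoInvFunAux v`
(`w ↦ (‖w‖² + 4)⁻¹ (4w + (‖w‖² − 4) v)`) at an arbitrary point `w`:
`D(w)ξ = (‖w‖²+4)⁻¹ (4ξ + 2⟪w,ξ⟫ v) − 2⟪w,ξ⟫ (‖w‖²+4)⁻² (4w + (‖w‖²−4) v)` (product and chain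
rules; Mathlib records only the differential at `w = 0`, `hasFDerivAt_stereoInvFunAux`).
[cite: Lee2018, Ch. 3, stereographic coordinates] -/
theorem hasFDerivAt_stereoInvFunAux_apply (v w : E) :
    ∃ L : E →L[ℝ] E, HasFDerivAt (stereoInvFunAux v) L w ∧ ∀ ξ : E,
      L ξ = (‖w‖ ^ 2 + 4)⁻¹ • ((4 : ℝ) • ξ + (2 * ⟪w, ξ⟫) • v) +
        (-((‖w‖ ^ 2 + 4) ^ 2)⁻¹ * (2 * ⟪w, ξ⟫)) • ((4 : ℝ) • w + (‖w‖ ^ 2 - 4) • v) := by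
  have h₀ : HasFDerivAt (fun w : E => ‖w‖ ^ 2) (2 • innerSL ℝ w) w :=
    (hasStrictFDerivAt_norm_sq w).hasFDerivAt
  have hpos : (‖w‖ ^ 2 + 4) ≠ 0 := by positivity
  have h₁ : HasFDerivAt (fun w : E => (‖w‖ ^ 2 + 4)⁻¹)
      ((-((‖w‖ ^ 2 + 4) ^ 2)⁻¹) • (2 • innerSL ℝ w)) w := by
    have := (hasDerivAt_inv hpos).comp_hasFDerivAt w (h₀.add_const 4)
    simpa [Function.comp_def] using this
  have h₂ : HasFDerivAt (fun w : E => (4 : ℝ) • w + (‖w‖ ^ 2 - 4) • v)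
      ((4 : ℝ) • ContinuousLinearMap.id ℝ E + (2 • innerSL ℝ w).smulRight v) w :=
    ((hasFDerivAt_id w).const_smul (4 : ℝ)).add ((h₀.sub_const 4).smul_const v)
  refine ⟨_, h₁.smul h₂, fun ξ ↦ ?_⟩
  simp only [add_apply, smul_apply,
    ContinuousLinearMap.smulRight_apply, ContinuousLinearMap.id_apply, innerSL_apply_apply,
    smul_eq_mul, nsmul_eq_mul, Nat.cast_ofNat]

/-- `stereoInvFunAux v` is differentiable (it is `C^∞`, Mathlib `contDiff_stereoInvFunAux`).
[folklore] -/
theorem differentiableAt_stereoInvFunAux (v w : E) : DifferentiableAt ℝ (stereoInvFunAux v) w :=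
  (contDiff_stereoInvFunAux (m := 1)).differentiable one_ne_zero w

/-- **The inverse stereographic projection is conformal.** For a unit vector `v` and
`w, ξ, η ⊥ v`, the differential `D(w)` of `stereoInvFunAux v` at `w` satisfies
`⟪D(w)ξ, D(w)η⟫ = (4/(‖w‖²+4))² ⟪ξ, η⟫`: the pull-back of the Euclidean (hence of the round)
metric under Mathlib's inverse stereographic projection is `(4/(‖w‖²+4))²` times the flat metric
of the hyperplane `vᗮ` (Lee 2018, Ch. 3: `(σ⁻¹)^* g̊ = 4|du|²/(1+|u|²)²` for the unscaled
projection `u = w/2`). [cite: Lee2018, Ch. 3, stereographic coordinates] -/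
theorem inner_fderiv_stereoInvFunAux {v : E} (hv : ‖v‖ = 1) {w ξ η : E} (hw : ⟪v, w⟫ = 0)
    (hξ : ⟪v, ξ⟫ = 0) (hη : ⟪v, η⟫ = 0) :
    ⟪fderiv ℝ (stereoInvFunAux v) w ξ, fderiv ℝ (stereoInvFunAux v) w η⟫ =
      (4 / (‖w‖ ^ 2 + 4)) ^ 2 * ⟪ξ, η⟫ := by
  obtain ⟨L, hL, hLapply⟩ := hasFDerivAt_stereoInvFunAux_apply v w
  rw [hL.fderiv, hLapply, hLapply]
  have hw' : ⟪w, v⟫ = 0 := by rw [real_inner_comm]; exact hw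
  have hξ' : ⟪ξ, v⟫ = 0 := by rw [real_inner_comm]; exact hξ
  have hvv : ⟪v, v⟫ = 1 := by rw [real_inner_self_eq_norm_sq, hv, one_pow]
  have hww : ⟪w, w⟫ = ‖w‖ ^ 2 := real_inner_self_eq_norm_sq w
  have hξw : ⟪ξ, w⟫ = ⟪w, ξ⟫ := real_inner_comm _ _
  have hpos : (‖w‖ ^ 2 + 4) ≠ 0 := by positivity
  simp only [inner_add_left, inner_add_right, inner_smul_left, inner_smul_right, hw, hw', hξ',
    hη, hvv, hww, hξw, RCLike.conj_to_real]
  field_simp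
  ring

end Stereographic

/-! ### The round metric in Mathlib's stereographic charts -/

section Chart

variable (V : Type*) [NormedAddCommGroup V] [InnerProductSpace ℝ V] {n : ℕ}
  [Fact (finrank ℝ V = n + 1)]

/-- **The round metric is conformally flat in the stereographic charts**: the Gram matrix
`h_{ij}(y) = g_S(∂ᵢ, ∂ⱼ)` (`chartGramMatrix`, `Lorentzian/Volume.lean`) of the round metric
`g_S = roundMetric V` in Mathlib's chart `extChartAt (𝓡 n) v` of the unit sphere (the
stereographic projection from `−v` followed by a linear isometry `(−v)ᗮ ≃ ℝⁿ`) is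
`(4/(‖y‖²+4))² δ_{ij}`: `g_S(∂ᵢ, ∂ⱼ) = ⟪dι ∂ᵢ, dι ∂ⱼ⟫ = ⟪D(ι∘σ⁻¹)eᵢ, D(ι∘σ⁻¹)eⱼ⟫`
(`roundMetric_apply`, chain rule) and `ι ∘ σ⁻¹` is `stereoInvFunAux (−v)` after the isometry,
which is conformal (`inner_fderiv_stereoInvFunAux`).
[cite: Lee2018, Ch. 3, stereographic coordinates] -/
theorem chartGramMatrix_roundMetric (v : sphere (0 : V) 1) (y : EuclideanSpace ℝ (Fin n))
    (i j : Fin n) :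
    chartGramMatrix ((roundMetric (n := n) V).toContMDiffRiemannianMetric isRiemannian_roundMetric)
        v y i j =
      (4 / (‖y‖ ^ 2 + 4)) ^ 2 * (if i = j then 1 else 0) := by
  haveI : FiniteDimensional ℝ V := .of_fact_finrank_eq_succ n
  simp only [chartGramMatrix, Matrix.of_apply, toContMDiffRiemannianMetric_inner]
  have hrange : range (𝓡 n) = univ := (𝓡 n).range_eq_univ
  rw [hrange, mfderivWithin_univ]
  set σ := chartAt (EuclideanSpace ℝ (Fin n)) v with hσ
  have hfun : ((extChartAt (𝓡 n) v).symm : EuclideanSpace ℝ (Fin n) → sphere (0 : V) 1) =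
      σ.symm := by
    rw [extChartAt_coe_symm, modelWithCornersSelf_coe_symm]
    rfl
  rw [hfun, roundMetric_apply]
  -- chain rule: `dι (dσ⁻¹ ξ) = D(ι ∘ σ⁻¹) ξ`
  have hy : y ∈ σ.target := by
    rw [hσ]
    change y ∈ (stereographic' n (-v)).target
    rw [stereographic'_target]
    exact mem_univ y
  have hσd : MDifferentiableAt 𝓘(ℝ, EuclideanSpace ℝ (Fin n)) (𝓡 n) σ.symm y :=
    (mdifferentiable_chart (I := 𝓡 n) v).mdifferentiableAt_symm hy
  have hcoe : MDifferentiableAt (𝓡 n) 𝓘(ℝ, V) ((↑) : sphere (0 : V) 1 → V) (σ.symm y) :=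
    (contMDiff_coe_sphere (m := 1)).mdifferentiableAt one_ne_zero
  have hchain : ∀ ξ : EuclideanSpace ℝ (Fin n),
      mfderiv (𝓡 n) 𝓘(ℝ, V) ((↑) : sphere (0 : V) 1 → V) (σ.symm y)
          (mfderiv 𝓘(ℝ, EuclideanSpace ℝ (Fin n)) (𝓡 n) σ.symm y ξ) =
        fderiv ℝ (fun z ↦ ((σ.symm z : sphere (0 : V) 1) : V)) y ξ := by
    intro ξ
    have hc := mfderiv_comp y hcoe hσd
    rw [← ContinuousLinearMap.comp_apply, ← hc, ← mfderiv_eq_fderiv]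
    rfl
  rw [hchain, hchain]
  -- the explicit formula for `ι ∘ σ⁻¹`
  set p : V := ((-v : sphere (0 : V) 1) : V) with hp
  set U : (ℝ ∙ p)ᗮ ≃ₗᵢ[ℝ] EuclideanSpace ℝ (Fin n) :=
    (OrthonormalBasis.fromOrthogonalSpanSingleton n (ne_zero_of_mem_unit_sphere (-v))).repr with hU
  set T : EuclideanSpace ℝ (Fin n) →L[ℝ] V :=
    (ℝ ∙ p)ᗮ.subtypeL.comp U.symm.toContinuousLinearEquiv.toContinuousLinearMap with hT
  have hT_apply : ∀ z, T z = ((U.symm z : (ℝ ∙ p)ᗮ) : V) := fun z ↦ rfl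
  have hformula : (fun z ↦ ((σ.symm z : sphere (0 : V) 1) : V)) = stereoInvFunAux p ∘ T := by
    funext z
    rfl
  have hfd : ∀ ξ : EuclideanSpace ℝ (Fin n),
      fderiv ℝ (fun z ↦ ((σ.symm z : sphere (0 : V) 1) : V)) y ξ =
        fderiv ℝ (stereoInvFunAux p) (T y) (T ξ) := by
    intro ξ
    rw [hformula, fderiv_comp y (differentiableAt_stereoInvFunAux p (T y)) T.differentiableAt,
      ContinuousLinearMap.fderiv, ContinuousLinearMap.comp_apply]
  rw [hfd, hfd]
  -- conformality of `stereoInvFunAux`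
  have hpn : ‖p‖ = 1 := by rw [hp]; exact norm_eq_of_mem_sphere (-v)
  have horth : ∀ z, ⟪p, T z⟫ = 0 := fun z ↦ by
    rw [hT_apply]
    exact Submodule.mem_orthogonal_singleton_iff_inner_right.1 (U.symm z).2
  change ⟪fderiv ℝ (stereoInvFunAux p) (T y) (T (EuclideanSpace.single i 1)),
      fderiv ℝ (stereoInvFunAux p) (T y) (T (EuclideanSpace.single j 1))⟫ = _
  rw [inner_fderiv_stereoInvFunAux hpn (horth y) (horth _) (horth _)]
  -- `T` is an isometry onto its image
  have hTnorm : ‖T y‖ = ‖y‖ := by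
    rw [hT_apply, Submodule.norm_coe, LinearIsometryEquiv.norm_map]
  have hTinner : ⟪T (EuclideanSpace.single i (1 : ℝ)), T (EuclideanSpace.single j (1 : ℝ))⟫ =
      if i = j then 1 else 0 := by
    rw [hT_apply, hT_apply, ← Submodule.coe_inner, LinearIsometryEquiv.inner_map_map]
    simp [EuclideanSpace.inner_single_left]
  rw [hTnorm, hTinner]

/-- As a matrix identity: `(h_{ij}(y)) = (4/(‖y‖²+4))² · 1`.
[cite: Lee2018, Ch. 3, stereographic coordinates] -/
theorem chartGramMatrix_roundMetric_eq_smul_one (v : sphere (0 : V) 1)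
    (y : EuclideanSpace ℝ (Fin n)) :
    chartGramMatrix ((roundMetric (n := n) V).toContMDiffRiemannianMetric isRiemannian_roundMetric)
        v y =
      (4 / (‖y‖ ^ 2 + 4)) ^ 2 • (1 : Matrix (Fin n) (Fin n) ℝ) := by
  ext i j
  rw [chartGramMatrix_roundMetric, Matrix.smul_apply, Matrix.one_apply, smul_eq_mul]

/-- **The Riemannian density of the round metric in a stereographic chart**:
`√(det h_{ij}(y)) = (4/(‖y‖²+4))ⁿ`. [cite: Lee2018, Prop. 2.41] -/
theorem sqrt_det_chartGramMatrix_roundMetric (v : sphere (0 : V) 1)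
    (y : EuclideanSpace ℝ (Fin n)) :
    Real.sqrt (chartGramMatrix
        ((roundMetric (n := n) V).toContMDiffRiemannianMetric isRiemannian_roundMetric) v y).det =
      (4 / (‖y‖ ^ 2 + 4)) ^ n := by
  rw [chartGramMatrix_roundMetric_eq_smul_one, Matrix.det_smul, Matrix.det_one, mul_one,
    Fintype.card_fin, ← pow_mul, show 2 * n = n * 2 from mul_comm _ _, pow_mul,
    Real.sqrt_sq (by positivity)]

end Chart

/-! ### The radial integral -/

section Integral

/-- `∫₀^∞ t³ (4/(t²+4))⁴ dt = 4/3`, with integrability, by the primitive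
`F(t) = −64 (t²+4)⁻² + (512/3)(t²+4)⁻³` (`F(0) = −4/3`, `F(∞) = 0`). [folklore] -/
theorem integral_radial_conformalFactor_four :
    ∫ t in Ioi (0 : ℝ), t ^ 3 * (4 / (t ^ 2 + 4)) ^ 4 = 4 / 3 ∧
      IntegrableOn (fun t : ℝ ↦ t ^ 3 * (4 / (t ^ 2 + 4)) ^ 4) (Ioi 0) := by
  set F : ℝ → ℝ := fun t ↦ -64 * ((t ^ 2 + 4) ^ 2)⁻¹ + 512 / 3 * ((t ^ 2 + 4) ^ 3)⁻¹ with hF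
  have hne : ∀ t : ℝ, t ^ 2 + 4 ≠ 0 := fun t ↦ by positivity
  have hderiv : ∀ t : ℝ, HasDerivAt F (t ^ 3 * (4 / (t ^ 2 + 4)) ^ 4) t := by
    intro t
    have h1 : HasDerivAt (fun t : ℝ ↦ t ^ 2 + 4) (2 * t) t := by
      simpa using ((hasDerivAt_id t).pow 2).add_const 4
    have h2 := h1.pow 2
    have h3 := h1.pow 3
    have h2' := h2.inv (pow_ne_zero 2 (hne t))
    have h3' := h3.inv (pow_ne_zero 3 (hne t))
    have h := (h2'.const_mul (-64)).add (h3'.const_mul (512 / 3))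
    refine h.congr_deriv ?_
    have ht := hne t
    simp only [Pi.pow_apply, Nat.cast_ofNat]
    field_simp
    ring
  have hlim : Tendsto F atTop (𝓝 0) := by
    have hsq : Tendsto (fun t : ℝ ↦ t ^ 2 + 4) atTop atTop :=
      tendsto_atTop_add_const_right _ _ (tendsto_pow_atTop two_ne_zero)
    have h2 : Tendsto (fun t : ℝ ↦ ((t ^ 2 + 4) ^ 2)⁻¹) atTop (𝓝 0) :=
      tendsto_inv_atTop_zero.comp (tendsto_pow_atTop two_ne_zero |>.comp hsq)
    have h3 : Tendsto (fun t : ℝ ↦ ((t ^ 2 + 4) ^ 3)⁻¹) atTop (𝓝 0) :=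
      tendsto_inv_atTop_zero.comp (tendsto_pow_atTop three_ne_zero |>.comp hsq)
    have := (h2.const_mul (-64)).add (h3.const_mul (512 / 3))
    simpa [hF] using this
  have hpos : ∀ t ∈ Ioi (0 : ℝ), 0 ≤ t ^ 3 * (4 / (t ^ 2 + 4)) ^ 4 := fun t ht ↦ by
    have : 0 < t := ht
    positivity
  have hcont : ContinuousWithinAt F (Ici 0) 0 := (hderiv 0).continuousAt.continuousWithinAt
  refine ⟨?_, integrableOn_Ioi_deriv_of_nonneg hcont (fun t _ ↦ hderiv t) hpos hlim⟩
  rw [integral_Ioi_of_hasDerivAt_of_nonneg hcont (fun t _ ↦ hderiv t) hpos hlim, hF]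
  norm_num

/-- **`∫_{ℝ⁴} (4/(‖y‖²+4))⁴ dy = 8π²/3`** (with integrability): polar coordinates
(`integral_fun_norm_addHaar`: `∫ f(‖y‖) dy = 4 |B⁴| ∫₀^∞ t³ f(t) dt`), `|B⁴| = π²/2`
(`InnerProductSpace.volume_ball_of_dim_even`) and `∫₀^∞ t³ (4/(t²+4))⁴ dt = 4/3`. [folklore] -/
theorem integral_conformalFactor_four :
    ∫ y : EuclideanSpace ℝ (Fin 4), (4 / (‖y‖ ^ 2 + 4)) ^ 4 = 8 * Real.pi ^ 2 / 3 ∧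
      Integrable (fun y : EuclideanSpace ℝ (Fin 4) ↦ (4 / (‖y‖ ^ 2 + 4)) ^ 4) := by
  obtain ⟨hI, hint⟩ := integral_radial_conformalFactor_four
  have hdim : finrank ℝ (EuclideanSpace ℝ (Fin 4)) = 4 := finrank_euclideanSpace_fin
  have hball : (volume : Measure (EuclideanSpace ℝ (Fin 4))).real (ball 0 1) = Real.pi ^ 2 / 2 := by
    rw [Measure.real, InnerProductSpace.volume_ball_of_dim_even (k := 2) (by rw [hdim]), hdim]
    rw [ENNReal.toReal_mul, ← ENNReal.ofReal_pow zero_le_one, ENNReal.toReal_ofReal (by positivity),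
      ENNReal.toReal_ofReal (by positivity)]
    norm_num
  refine ⟨?_, ?_⟩
  · have h := integral_fun_norm_addHaar (volume : Measure (EuclideanSpace ℝ (Fin 4)))
      (fun t : ℝ ↦ (4 / (t ^ 2 + 4)) ^ 4)
    rw [h, hdim, hball]
    simp only [smul_eq_mul, nsmul_eq_mul, Nat.cast_ofNat]
    have h3 : ∫ t in Ioi (0 : ℝ), t ^ (4 - 1) * (4 / (t ^ 2 + 4)) ^ 4 = 4 / 3 := by
      simpa using hI
    rw [h3]
    ring
  · refine (integrable_fun_norm_addHaar (volume : Measure (EuclideanSpace ℝ (Fin 4)))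
      (f := fun t : ℝ ↦ (4 / (t ^ 2 + 4)) ^ 4)).2 ?_
    rw [hdim]
    simpa [smul_eq_mul] using hint

end Integral

/-! ### The volume of the round `S⁴` -/

section Volume

variable (V : Type*) [NormedAddCommGroup V] [InnerProductSpace ℝ V] [Fact (finrank ℝ V = 4 + 1)]
  [MeasurableSpace V] [BorelSpace V]

/-- **`Vol(S⁴) = ω₄ = 8π²/3`**: the total Riemannian measure of the round metric on the unit
sphere of a `5`-dimensional real inner product space is `8π²/3` (Aubin 1982, Thm. 6.7: `ω_n` =
volume of the unit `n`-sphere; `ω₄ = 2π^{5/2}/Γ(5/2) = 8π²/3`). Proof: the stereographic chart at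
`v` covers the sphere up to the point `−v`, which is null for `dV` (chart formula at `−v` over a
Lebesgue-null singleton); on the chart domain `dV` is Lebesgue measure with density
`√(det h_{ij}) = (4/(‖y‖²+4))⁴` (`map_extChartAt_restrict_riemannianMeasure`,
`sqrt_det_chartGramMatrix_roundMetric`), whose integral is `8π²/3`
(`integral_conformalFactor_four`). [cite: Aubin1982, Ch. 6, Thm. 6.7] [cite: Lee2018, Prop. 2.41] -/
theorem riemannianMeasure_roundMetric_sphere_four_univ :
    riemannianMeasure
        ((roundMetric (n := 4) V).toContMDiffRiemannianMetric isRiemannian_roundMetric) univ =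
      ENNReal.ofReal (8 * Real.pi ^ 2 / 3) := by
  haveI : FiniteDimensional ℝ V := .of_fact_finrank_eq_succ 4
  set G := (roundMetric (n := 4) V).toContMDiffRiemannianMetric isRiemannian_roundMetric with hG
  set μ : Measure (sphere (0 : V) 1) := riemannianMeasure G with hμ
  -- points are null
  have hpt : ∀ x : sphere (0 : V) 1, μ {x} = 0 := by
    intro x
    have h := riemannianMeasure_eq_integral_sqrt_det_holds G x (measurableSet_singleton x)
      (singleton_subset_iff.2 (mem_extChartAt_source x))
    rw [hμ, h, image_singleton]
    exact setLIntegral_measure_zero _ _ (measure_singleton _)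
  -- one chart suffices
  haveI : Nontrivial V := Module.nontrivial_of_finrank_eq_succ (Fact.out : finrank ℝ V = 4 + 1)
  obtain ⟨v⟩ : Nonempty (sphere (0 : V) 1) :=
    (NormedSpace.sphere_nonempty.2 zero_le_one).to_subtype
  have hsrc : (extChartAt (𝓡 4) v).source = {-v}ᶜ := by
    rw [extChartAt_source]
    exact stereographic'_source (-v)
  have htgt : (extChartAt (𝓡 4) v).target = univ := by
    rw [extChartAt_target, ModelWithCorners.range_eq_univ, inter_univ,
      modelWithCornersSelf_coe_symm, preimage_id_eq, id]
    exact stereographic'_target (-v)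
  have huniv : μ univ = μ (extChartAt (𝓡 4) v).source := by
    rw [hsrc, measure_compl (measurableSet_singleton _) (by rw [hpt]; exact ENNReal.zero_ne_top),
      hpt, tsub_zero]
  -- the chart formula
  have hchart : μ (extChartAt (𝓡 4) v).source =
      ∫⁻ y : EuclideanSpace ℝ (Fin 4), ENNReal.ofReal ((4 / (‖y‖ ^ 2 + 4)) ^ 4) := by
    have h1 : μ (extChartAt (𝓡 4) v).source =
        ((μ.restrict (extChartAt (𝓡 4) v).source).map (extChartAt (𝓡 4) v)) univ := by
      rw [Measure.map_apply_of_aemeasurable (aemeasurable_extChartAt_restrict v _)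
        MeasurableSet.univ, preimage_univ, Measure.restrict_apply MeasurableSet.univ, univ_inter]
    rw [h1, hμ, map_extChartAt_restrict_riemannianMeasure G v,
      withDensity_apply _ MeasurableSet.univ, Measure.restrict_univ, htgt, Measure.restrict_univ]
    refine lintegral_congr (fun y ↦ ?_)
    rw [hG, sqrt_det_chartGramMatrix_roundMetric]
  obtain ⟨hI, hint⟩ := integral_conformalFactor_four
  rw [huniv, hchart, ← hI]
  exact (ofReal_integral_eq_lintegral_ofReal hint (Eventually.of_forall fun y ↦ by positivity)).symm

/-- `Vol(S⁴) = 8π²/3` as a real number. [cite: Aubin1982, Ch. 6, Thm. 6.7] -/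
theorem toReal_riemannianMeasure_roundMetric_sphere_four_univ :
    (riemannianMeasure ((roundMetric (n := 4) V).toContMDiffRiemannianMetric
        isRiemannian_roundMetric) univ).toReal =
      8 * Real.pi ^ 2 / 3 := by
  rw [riemannianMeasure_roundMetric_sphere_four_univ, ENNReal.toReal_ofReal (by positivity)]

end Volume

end Literature.Geometry.Riemannian

end
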